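import Summits.ValiantsHypothesis.ValiantsHypothesis.Theorems.LangWeilTransferTameResolutionParamIdentity
import Summits.ValiantsHypothesis.ValiantsHypothesis.Theorems.LangWeilTransferTameResolutionDerivative
import Summits.ValiantsHypothesis.ValiantsHypothesis.Theorems.LangWeilTransferTameResolutionBezout
import Summits.ValiantsHypothesis.ValiantsHypothesis.Theorems.LangWeilTransferTameResolutionBezoutExplicit
import Summits.ValiantsHypothesis.ValiantsHypothesis.Theorems.LangWeilTransferTameResolutionChoice
import Summits.ValiantsHypothesis.ValiantsHypothesis.Theorems.LangWeilTransferTameResolutionLeadingCoeff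
import Literature.AlgebraicGeometry.Motives.CurveThroughTwoPointsHypersurfaceModel

/-!
# LangWeilTransfer, support item `TameResolution` (stmt-ValiantsHypothesis-6378) — the integer
# Kronecker parametrisation in Noether position, WITH PROVENANCE (input of the quantitative pass)

Route `LangWeilTransfer` of `ValiantsHypothesis` (conditional route; honest framing: bookkeeping,
nothing here bears on VP ≠ VNP). Same construction and proof as `exists_parametrisation`
(`LangWeilTransferTameResolutionParam`), but the statement EXPORTS the data the size bounds are
computed from (roadmap note of val-lit-p6 g9, §1(A)): the specialisation `a ∈ ℕ^{n×t}` of the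
combination coefficients with `a ≤ max deg coeff(𝒬)`, the irreducible factor `q ∣ 𝒬_a`, the Bézout
cofactor `B` of `q'` with its coefficients as adjugate entries of the Sylvester matrix
(`exists_bezout_explicit`), the specialisation `c ∈ ℕⁿ` of `Λ` with `c ≤ deg(Res · lc q)`, and the
definitions `ρ = Res(Λ := c)`, `V_j = -(∂_{Λ_j} q · B)(Λ := c)`, `u = Σ_j c_j ξ_j`, `Q ∣ q(Λ := c)`.

* `totalDegree_aeval_le_mul_of_algebra`, `totalDegree_sumAlgEquiv_le` — splitting variables does not
  increase the (outer) total degree;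
* `exists_parametrisation_explicit`.
-/

noncomputable section

open MvPolynomial
open Literature.RingTheory.Elimination

-- the summit and the problem share the name `ValiantsHypothesis` (D-0017 single-conjunct layout)
set_option linter.dupNamespace false

namespace Summit.ValiantsHypothesis.ValiantsHypothesis.Theorems.LangWeilTransfer

variable {F₀ : Type*} [Field F₀] {r n t d : ℕ}

/-- Total degree under substitution into polynomials over an algebra: if every `g_v` has total
degree `≤ e`, then `deg (aeval g F) ≤ e · deg F`. -/
theorem totalDegree_aeval_le_mul_of_algebra {R A : Type*} [CommRing R] [CommRing A] [Algebra R A]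
    {σ τ : Type*} (g : σ → MvPolynomial τ A) {e : ℕ} (hg : ∀ v, (g v).totalDegree ≤ e) (F : MvPolynomial σ R) :
    (aeval g F).totalDegree ≤ e * F.totalDegree := by
  classical
  conv_lhs => rw [F.as_sum]
  rw [map_sum]
  refine totalDegree_finsetSum_le fun d hd => ?_
  rw [aeval_monomial, MvPolynomial.algebraMap_apply]
  refine (totalDegree_mul _ _).trans ?_
  rw [totalDegree_C, zero_add]
  simp only [Finsupp.prod]
  refine (totalDegree_finsetProd _ _).trans ?_
  calc ∑ i ∈ d.support, (g i ^ d i).totalDegree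
      ≤ ∑ i ∈ d.support, d i * e := Finset.sum_le_sum fun i _ =>
          (totalDegree_pow _ _).trans (Nat.mul_le_mul_left _ (hg i))
    _ = (∑ i ∈ d.support, d i) * e := (Finset.sum_mul _ _ _).symm
    _ ≤ F.totalDegree * e := Nat.mul_le_mul_right _ (le_totalDegree hd)
    _ = e * F.totalDegree := mul_comm _ _

/-- Splitting the variables (`sumAlgEquiv`) does not increase the outer total degree. -/
theorem totalDegree_sumAlgEquiv_le {R : Type*} [CommRing R] {S₁ S₂ : Type*} (f : MvPolynomial (S₁ ⊕ S₂) R) :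
    (sumAlgEquiv R S₁ S₂ f).totalDegree ≤ f.totalDegree := by
  have h : (sumAlgEquiv R S₁ S₂).toAlgHom = aeval (Sum.elim X (fun j => C (X j))) := by
    refine MvPolynomial.algHom_ext fun v => ?_
    rw [AlgEquiv.toAlgHom_apply, aeval_X]
    rcases v with i | j
    · rw [Sum.elim_inl]; simp only [sumAlgEquiv_X_inl]
    · rw [Sum.elim_inr]; simp only [sumAlgEquiv_X_inr]
  have h' : sumAlgEquiv R S₁ S₂ f = aeval (Sum.elim X (fun j => C (X j))) f := by
    have := AlgHom.congr_fun h f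
    rwa [AlgEquiv.toAlgHom_apply] at this
  rw [h']
  refine (totalDegree_aeval_le_mul_of_algebra (Sum.elim X (fun j => C (X j))) (e := 1) (fun v => ?_) f).trans
    (by rw [one_mul])
  rcases v with i | j
  · rw [Sum.elim_inl]
    rcases subsingleton_or_nontrivial (MvPolynomial S₂ R) with hR | hR
    · rw [Subsingleton.elim (X i : MvPolynomial S₁ (MvPolynomial S₂ R)) 0, totalDegree_zero]
      exact zero_le_one
    · rw [totalDegree_X]
  · rw [Sum.elim_inr, totalDegree_C]; exact Nat.zero_le _

/-- **Integer Kronecker parametrisation in Noether position, with provenance.** Hypotheses as in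
`exists_parametrisation`; the conclusion names `a, q, B, c, Q, cQ` and DEFINES `σ_a, Res, sp, ∂_j q,
ρ, V, u` from them (see the module docstring). -/
theorem exists_parametrisation_explicit
    (S : Fin t → MvPolynomial (Fin n) (MvPolynomial (Fin r) ℤ)) (hSd : ∀ k, (S k).totalDegree ≤ d)
    (φ : MvPolynomial (Fin n) (MvPolynomial (Fin r) ℤ) →+* F₀)
    (θℚ : MvPolynomial (Fin r) ℚ →+* F₀) (hθℚX : ∀ k, θℚ (X k) = φ (C (X k)))
    (hθℚ : Function.Injective θℚ)
    (halg : ∀ j, ∃ P : Polynomial (MvPolynomial (Fin r) ℤ), P ≠ 0 ∧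
      (P.map (φ.comp MvPolynomial.C)).eval (φ (X j)) = 0)
    (hint : ∀ j, ∃ p : Polynomial (MvPolynomial (Fin r) ℚ), p.Monic ∧ (p.map θℚ).eval (φ (X j)) = 0)
    (hSφ : ∀ k, φ (S k) = 0)
    (hmin : ∀ 𝔮 : Ideal (MvPolynomial (Fin n) (MvPolynomial (Fin r) ℤ)), 𝔮.IsPrime →
      Ideal.span (Set.range S) ≤ 𝔮 → 𝔮 ≤ RingHom.ker φ → 𝔮 = RingHom.ker φ) :
    let ι := Fin r ⊕ (Fin n ⊕ (Fin n × Fin t))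
    let F : Fin n → MvPolynomial (Fin n) (MvPolynomial ι ℤ) := fun i =>
      ∑ k, C (X (Sum.inr (Sum.inr (i, k)))) *
        MvPolynomial.map (rename (Sum.inl : Fin r → ι) : MvPolynomial (Fin r) ℤ →ₐ[ℤ] MvPolynomial ι ℤ).toRingHom (S k)
    let uU : MvPolynomial (Fin n) (MvPolynomial ι ℤ) := ∑ j, C (X (Sum.inr (Sum.inl j))) * X j
    let 𝒬 := sLead (pertCharpoly (d + 1) F uU (1 + n * d + 1))
    ∃ (a : Fin n × Fin t → ℕ) (q B : Polynomial (MvPolynomial (Fin n) (MvPolynomial (Fin r) ℤ)))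
      (c : Fin n → ℕ) (Q : Polynomial (MvPolynomial (Fin r) ℤ)) (cQ : ℤ),
      let σa : MvPolynomial ι ℤ →+* MvPolynomial (Fin n) (MvPolynomial (Fin r) ℤ) :=
        eval₂Hom (C.comp C) (Sum.elim (fun k => C (X k)) (Sum.elim (fun j => X j) (fun p => C (C ((a p : ℕ) : ℤ)))))
      let Res := Polynomial.resultant q (Polynomial.derivative q) q.natDegree (Polynomial.derivative q).natDegree
      let sp : MvPolynomial (Fin n) (MvPolynomial (Fin r) ℤ) →+* MvPolynomial (Fin r) ℤ :=
        eval fun j => ((c j : ℕ) : MvPolynomial (Fin r) ℤ)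
      let dq : Fin n → Polynomial (MvPolynomial (Fin n) (MvPolynomial (Fin r) ℤ)) := fun j =>
        optionEquivLeft _ (Fin n) (pderiv (some j) ((optionEquivLeft _ (Fin n)).symm q))
      let ρ := sp Res
      let V : Fin n → Polynomial (MvPolynomial (Fin r) ℤ) := fun j => -((dq j * B).map sp)
      let u : F₀ := ∑ j, ((c j : ℕ) : F₀) * φ (X j)
      (∀ p, a p ≤ 𝒬.support.sup fun k => (𝒬.coeff k).totalDegree) ∧
      Irreducible q ∧ 0 < q.natDegree ∧ q ∣ 𝒬.map σa ∧
      B.degree < (q.natDegree : WithBot ℕ) ∧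
      (∀ i : ℕ, B.coeff i = if h : i < q.natDegree then
        (Polynomial.sylvester q (Polynomial.derivative q) q.natDegree (Polynomial.derivative q).natDegree).adjugate
          (Fin.castAdd _ ⟨i, h⟩) ⟨0, by omega⟩ else 0) ∧
      (∀ j, c j ≤ (Res * q.leadingCoeff).totalDegree) ∧
      Q ∣ q.map sp ∧ cQ ≠ 0 ∧ ρ ≠ 0 ∧ Q.leadingCoeff = C cQ ∧ 0 < Q.natDegree ∧
      Irreducible (Q.map (MvPolynomial.map (Int.castRingHom ℚ))) ∧
      (Q.map (φ.comp MvPolynomial.C)).eval u = 0 ∧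
      (∀ j, φ (X j) * (φ.comp MvPolynomial.C) ρ = ((V j).map (φ.comp MvPolynomial.C)).eval u) ∧
      (∀ G : Polynomial (MvPolynomial (Fin r) ℚ), (G.map θℚ).eval u = 0 →
        Q.map (MvPolynomial.map (Int.castRingHom ℚ)) ∣ G) := by
  intro ι F uU 𝒬
  classical
  -- injectivity of `θ = φ ∘ C : ℤ[T] → F₀` (it factors through the injective `θℚ`)
  set θ : MvPolynomial (Fin r) ℤ →+* F₀ := φ.comp MvPolynomial.C with hθdef
  have hθℚcomp : θℚ.comp (MvPolynomial.map (Int.castRingHom ℚ)) = θ := by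
    refine MvPolynomial.ringHom_ext (fun z => ?_) (fun k => ?_)
    · simp only [eq_intCast, map_intCast]
    · simp only [RingHom.comp_apply, map_X, hθℚX, hθdef]
  have hT : Function.Injective θ := by
    rw [← hθℚcomp]
    exact hθℚ.comp (MvPolynomial.map_injective _ (RingHom.injective_int (Int.castRingHom ℚ)))
  set ξ : Fin n → F₀ := fun j => φ (X j) with hξ
  -- the universal eliminant
  have h𝒬 : 𝒬 = sLead (pertCharpoly (d + 1) F uU (1 + n * d + 1)) := rfl
  have h𝒬0 : 𝒬 ≠ 0 := sLead_ne_zero (pertCharpoly_ne_zero _ _ _ _)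
  -- STEP A: specialise `α ↦ a ∈ ℕ^{n×t}` keeping `𝒬` non-zero
  obtain ⟨k₀, hk₀⟩ : ∃ k, 𝒬.coeff k ≠ 0 := by
    by_contra h
    push Not at h
    exact h𝒬0 (Polynomial.ext fun k => by rw [h k, Polynomial.coeff_zero])
  -- reorganise the universal ring: `α` outer, `T ⊔ Λ` inner
  let eι : ι ≃ (Fin n × Fin t) ⊕ (Fin r ⊕ Fin n) :=
    { toFun := fun v => match v with
        | Sum.inl k => Sum.inr (Sum.inl k)
        | Sum.inr (Sum.inl j) => Sum.inr (Sum.inr j)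
        | Sum.inr (Sum.inr p) => Sum.inl p
      invFun := fun w => match w with
        | Sum.inl p => Sum.inr (Sum.inr p)
        | Sum.inr (Sum.inl k) => Sum.inl k
        | Sum.inr (Sum.inr j) => Sum.inr (Sum.inl j)
      left_inv := fun v => by rcases v with k | j | p <;> rfl
      right_inv := fun w => by rcases w with p | k | j <;> rfl }
  have heι₁ : ∀ k, eι (Sum.inl k) = Sum.inr (Sum.inl k) := fun _ => rfl
  have heι₂ : ∀ j, eι (Sum.inr (Sum.inl j)) = Sum.inr (Sum.inr j) := fun _ => rfl
  have heι₃ : ∀ p, eι (Sum.inr (Sum.inr p)) = Sum.inl p := fun _ => rfl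
  let E₁ : MvPolynomial ι ℤ ≃ₐ[ℤ] MvPolynomial (Fin n × Fin t) (MvPolynomial (Fin r ⊕ Fin n) ℤ) :=
    (renameEquiv ℤ eι).trans (sumAlgEquiv ℤ (Fin n × Fin t) (Fin r ⊕ Fin n))
  -- `T ⊔ Λ`-polynomials into `ℤ[T][Λ]`
  let E₂ : MvPolynomial (Fin r ⊕ Fin n) ℤ →+* MvPolynomial (Fin n) (MvPolynomial (Fin r) ℤ) :=
    eval₂Hom (C.comp C) (Sum.elim (fun k => C (X k)) (fun j => X j))
  have hE₂inj : Function.Injective E₂ := by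
    -- `E₂` is the isomorphism `sumAlgEquiv` after swapping the summands
    have hE : E₂ = ((sumAlgEquiv ℤ (Fin n) (Fin r)).toRingEquiv.toRingHom.comp
        (rename (Equiv.sumComm (Fin r) (Fin n)) : MvPolynomial (Fin r ⊕ Fin n) ℤ →ₐ[ℤ] _).toRingHom) := by
      refine MvPolynomial.ringHom_ext (fun z => ?_) (fun v => ?_)
      · simp only [eq_intCast, map_intCast]
      · rcases v with k | j
        · simp only [E₂, eval₂Hom_X', Sum.elim_inl, RingHom.comp_apply, AlgHom.toRingHom_eq_coe,
            RingHom.coe_coe, rename_X, Equiv.sumComm_apply, Sum.swap_inl, RingEquiv.toRingHom_eq_coe,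
            AlgEquiv.toRingEquiv_toRingHom, sumAlgEquiv_X_inr]
        · simp only [E₂, eval₂Hom_X', Sum.elim_inr, RingHom.comp_apply, AlgHom.toRingHom_eq_coe,
            RingHom.coe_coe, rename_X, Equiv.sumComm_apply, Sum.swap_inr, RingEquiv.toRingHom_eq_coe,
            AlgEquiv.toRingEquiv_toRingHom, sumAlgEquiv_X_inl]
    rw [hE]
    exact (sumAlgEquiv ℤ (Fin n) (Fin r)).injective.comp (rename_injective _ (Equiv.injective _))
  set c₀ := E₁ (𝒬.coeff k₀) with hc₀
  have hc₀0 : c₀ ≠ 0 := by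
    rw [hc₀]; exact (EmbeddingLike.map_ne_zero_iff).2 hk₀
  obtain ⟨a, haN, ha⟩ := exists_nat_le_eval_ne_zero c₀ hc₀0 (fun i => degreeOf_le_totalDegree c₀ i)
  have haN' : ∀ p, a p ≤ 𝒬.support.sup fun k => (𝒬.coeff k).totalDegree := by
    intro p
    refine (haN p).trans ?_
    have h1 : c₀.totalDegree ≤ (𝒬.coeff k₀).totalDegree := by
      rw [hc₀]
      change (sumAlgEquiv ℤ (Fin n × Fin t) (Fin r ⊕ Fin n) (renameEquiv ℤ eι (𝒬.coeff k₀))).totalDegree ≤ _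
      refine (totalDegree_sumAlgEquiv_le _).trans ?_
      rw [renameEquiv_apply]
      exact totalDegree_rename_le _ _
    exact h1.trans (Finset.le_sup (f := fun k => (𝒬.coeff k).totalDegree) (Polynomial.mem_support_iff.2 hk₀))
  -- the specialisation `σ_a`
  let σa : MvPolynomial ι ℤ →+* MvPolynomial (Fin n) (MvPolynomial (Fin r) ℤ) :=
    eval₂Hom (C.comp C) (Sum.elim (fun k => C (X k)) (Sum.elim (fun j => X j) (fun p => C (C ((a p : ℕ) : ℤ)))))
  have hσa : σa = E₂.comp ((eval fun p => ((a p : ℕ) : MvPolynomial (Fin r ⊕ Fin n) ℤ)).comp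
      E₁.toRingEquiv.toRingHom) := by
    refine MvPolynomial.ringHom_ext (fun z => ?_) (fun v => ?_)
    · simp only [eq_intCast, map_intCast]
    · rcases v with k | j | p
      · simp only [σa, E₁, E₂, eval₂Hom_X', Sum.elim_inl, RingHom.comp_apply,
          RingEquiv.toRingHom_eq_coe, AlgEquiv.toRingEquiv_toRingHom, RingHom.coe_coe, AlgEquiv.trans_apply,
          renameEquiv_apply, rename_X, heι₁, sumAlgEquiv_X_inr, eval_C]
      · simp only [σa, E₁, E₂, eval₂Hom_X', Sum.elim_inr, Sum.elim_inl, RingHom.comp_apply,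
          RingEquiv.toRingHom_eq_coe, AlgEquiv.toRingEquiv_toRingHom, RingHom.coe_coe, AlgEquiv.trans_apply,
          renameEquiv_apply, rename_X, heι₂, sumAlgEquiv_X_inr, eval_C]
      · simp only [σa, E₁, E₂, eval₂Hom_X', Sum.elim_inr, RingHom.comp_apply,
          RingEquiv.toRingHom_eq_coe, AlgEquiv.toRingEquiv_toRingHom, RingHom.coe_coe, AlgEquiv.trans_apply,
          renameEquiv_apply, rename_X, heι₃, sumAlgEquiv_X_inl, eval_X, map_natCast]
  set 𝒬a := 𝒬.map σa with h𝒬a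
  have h𝒬a0 : 𝒬a ≠ 0 := by
    intro h0
    have h1 : σa (𝒬.coeff k₀) = 0 := by
      have := congrArg (fun p => p.coeff k₀) h0
      simpa only [h𝒬a, Polynomial.coeff_map, Polynomial.coeff_zero] using this
    rw [hσa, RingHom.comp_apply, RingHom.comp_apply] at h1
    have h2 := (injective_iff_map_eq_zero E₂).1 hE₂inj _ h1
    exact ha h2
  -- the identity for `𝒬_a`
  have hid : Polynomial.eval₂ (MvPolynomial.map θ) (∑ j, C (ξ j) * X j) 𝒬a = 0 := by
    have h := eliminant_identity_specialize S hSd φ hT halg hSφ hmin (fun p => ((a p : ℕ) : ℤ))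
    simp only at h
    exact h
  -- STEP B: an irreducible factor through the point
  set Φ : Polynomial (MvPolynomial (Fin n) (MvPolynomial (Fin r) ℤ)) →+* MvPolynomial (Fin n) F₀ :=
    Polynomial.eval₂RingHom (MvPolynomial.map θ) (∑ j, C (ξ j) * X j) with hΦ
  have hΦ𝒬 : Φ 𝒬a = 0 := by rw [hΦ, Polynomial.coe_eval₂RingHom]; exact hid
  obtain ⟨q, hqirr, hq𝒬, hΦq⟩ := exists_irreducible_dvd_map_eq_zero
    (R := Polynomial (MvPolynomial (Fin n) (MvPolynomial (Fin r) ℤ))) (K := MvPolynomial (Fin n) F₀) Φ h𝒬a0 hΦ𝒬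
  have hmapθinj : Function.Injective (MvPolynomial.map (σ := Fin n) θ) := MvPolynomial.map_injective θ hT
  have hqdeg : 0 < q.natDegree := by
    by_contra h0
    push Not at h0
    have hq0 : q.natDegree = 0 := Nat.le_zero.1 h0
    obtain ⟨b, hb⟩ := Polynomial.natDegree_eq_zero.1 hq0
    have : b = 0 := by
      apply hmapθinj
      rw [map_zero]
      have h := hΦq
      rw [← hb, hΦ, Polynomial.coe_eval₂RingHom, Polynomial.eval₂_C] at h
      exact h
    rw [this, map_zero] at hb
    exact hqirr.ne_zero hb.symm
  -- STEP C: the derivative identity  `Φ(q') ξ_j + Φ(∂_j q) = 0`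
  set dq : Fin n → Polynomial (MvPolynomial (Fin n) (MvPolynomial (Fin r) ℤ)) := fun j =>
    optionEquivLeft _ (Fin n) (pderiv (some j) ((optionEquivLeft _ (Fin n)).symm q)) with hdq
  have hder : ∀ j, Φ (Polynomial.derivative q) * C (ξ j) + Φ (dq j) = 0 := by
    intro j
    have h := derivative_identity θ ξ q (by rw [hΦ, Polynomial.coe_eval₂RingHom] at hΦq; exact hΦq) j
    rw [hΦ, Polynomial.coe_eval₂RingHom]
    exact h
  -- STEP D: Bézout  `A q + B q' = Res ≠ 0`
  have hRes0 := resultant_derivative_ne_zero hqirr hqdeg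
  obtain ⟨A, B, -, hBdeg, hbez0, hBcoeff, -⟩ := exists_bezout_explicit q (Polynomial.derivative q) le_rfl le_rfl
    (Or.inl (by omega))
  set Res := Polynomial.resultant q (Polynomial.derivative q) q.natDegree (Polynomial.derivative q).natDegree
    with hResdef
  have hbez : A * q + B * Polynomial.derivative q = Polynomial.C Res := by
    rw [mul_comm A, mul_comm B]; exact hbez0
  -- STEP E: specialise `Λ ↦ c ∈ ℕⁿ` keeping `Res` and the leading coefficient of `q` non-zero
  have hg0 : Res * q.leadingCoeff ≠ 0 := mul_ne_zero hRes0 (Polynomial.leadingCoeff_ne_zero.2 hqirr.ne_zero)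
  obtain ⟨c, hcN, hc⟩ := exists_nat_le_eval_ne_zero (Res * q.leadingCoeff) hg0
    (fun i => degreeOf_le_totalDegree _ i)
  set sp : MvPolynomial (Fin n) (MvPolynomial (Fin r) ℤ) →+* MvPolynomial (Fin r) ℤ :=
    eval fun j => ((c j : ℕ) : MvPolynomial (Fin r) ℤ) with hsp
  have hspRes : sp Res ≠ 0 := by
    intro h0; apply hc; rw [map_mul]; rw [hsp] at h0; rw [h0, zero_mul]
  have hsplc : sp q.leadingCoeff ≠ 0 := by
    intro h0; apply hc; rw [map_mul]; rw [hsp] at h0; rw [h0, mul_zero]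
  -- the primitive element and the evaluation `ψ` at `(T̄, u)`
  set u : F₀ := ∑ j, (c j : F₀) * ξ j with hu
  set ψ : Polynomial (MvPolynomial (Fin r) ℤ) →+* F₀ := Polynomial.eval₂RingHom θ u with hψ
  set evc : MvPolynomial (Fin n) F₀ →+* F₀ := eval fun j => (c j : F₀) with hevc
  have hcompat : evc.comp Φ = ψ.comp (Polynomial.mapRingHom sp) := by
    refine Polynomial.ringHom_ext (fun b => ?_) ?_
    · rw [RingHom.comp_apply, RingHom.comp_apply, hΦ, Polynomial.coe_eval₂RingHom, Polynomial.eval₂_C,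
        Polynomial.coe_mapRingHom, Polynomial.map_C, hψ, Polynomial.coe_eval₂RingHom, Polynomial.eval₂_C]
      -- `eval_c (map θ b) = θ (sp b)`
      have : (evc.comp (MvPolynomial.map θ)) = θ.comp sp := by
        refine MvPolynomial.ringHom_ext (fun a₀ => ?_) (fun j => ?_)
        · simp only [hevc, hsp, RingHom.comp_apply, map_C, eval_C]
        · simp only [hevc, hsp, RingHom.comp_apply, map_X, eval_X, map_natCast]
      exact congrArg (fun g => g b) this
    · rw [RingHom.comp_apply, RingHom.comp_apply, hΦ, Polynomial.coe_eval₂RingHom, Polynomial.eval₂_X,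
        Polynomial.coe_mapRingHom, Polynomial.map_X, hψ, Polynomial.coe_eval₂RingHom, Polynomial.eval₂_X]
      simp only [hevc, hu, map_sum, map_mul, eval_C, eval_X]
      exact Finset.sum_congr rfl fun j _ => mul_comm _ _
  have hevΦ : ∀ G, evc (Φ G) = ψ (G.map sp) := fun G => by
    have := congrArg (fun g => g G) hcompat
    simpa only [RingHom.comp_apply, Polynomial.coe_mapRingHom] using this
  -- consequences at `Λ = c`
  have hψq : ψ (q.map sp) = 0 := by rw [← hevΦ, hΦq, map_zero]
  have hθρ : θ (sp Res) ≠ 0 := fun h => hspRes (hT (by rw [h, map_zero]))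
  have hbez' : ψ (B.map sp) * ψ ((Polynomial.derivative q).map sp) = θ (sp Res) := by
    have h := congrArg (fun G => ψ (Polynomial.map sp G)) hbez
    simp only [Polynomial.map_add, Polynomial.map_mul, map_add, map_mul, hψq, mul_zero, zero_add,
      Polynomial.map_C] at h
    rw [h, hψ, Polynomial.coe_eval₂RingHom, Polynomial.eval₂_C]
  have hder' : ∀ j, ψ ((Polynomial.derivative q).map sp) * ξ j + ψ ((dq j).map sp) = 0 := by
    intro j
    have h := congrArg evc (hder j)
    rw [map_zero, map_add, map_mul, hevΦ, hevΦ] at h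
    simpa only [hevc, eval_C] using h
  -- the numerators
  set V : Fin n → Polynomial (MvPolynomial (Fin r) ℤ) := (fun j => -((dq j * B).map sp)) with hV
  have hgraph : ∀ j, ξ j * θ (sp Res) = ψ (V j) := by
    intro j
    have h1 := hder' j
    rw [hV]; dsimp only
    rw [map_neg, Polynomial.map_mul, map_mul, ← hbez']
    have : ψ ((dq j).map sp) = -(ψ ((Polynomial.derivative q).map sp) * ξ j) := by
      rw [eq_neg_iff_add_eq_zero, add_comm]; exact h1
    rw [this]; ring
  -- STEP F: the irreducible factor `Q` of `q_c` through `u`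
  have hqc0 : q.map sp ≠ 0 := by
    intro h0
    have := Polynomial.leadingCoeff_map_of_leadingCoeff_ne_zero sp hsplc
    rw [h0, Polynomial.leadingCoeff_zero] at this
    exact hsplc this.symm
  obtain ⟨Q, hQirr, hQdvd, hψQ⟩ := exists_irreducible_dvd_map_eq_zero
    (R := Polynomial (MvPolynomial (Fin r) ℤ)) (K := F₀) ψ hqc0 hψq
  have hQdeg : 0 < Q.natDegree := by
    by_contra h0
    push Not at h0
    obtain ⟨b, hb⟩ := Polynomial.natDegree_eq_zero.1 (Nat.le_zero.1 h0)
    have : b = 0 := by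
      apply hT
      rw [map_zero]
      have h := hψQ
      rw [← hb, hψ, Polynomial.coe_eval₂RingHom, Polynomial.eval₂_C] at h
      exact h
    rw [this, map_zero] at hb
    exact hQirr.ne_zero hb.symm
  -- irreducibility over `ℚ` (Gauss, through `ℤ[T][U] ≅ ℤ[X_0, …, X_r]`)
  set Qℚ := Q.map (MvPolynomial.map (Int.castRingHom ℚ)) with hQℚ
  have hQℚirr : Irreducible Qℚ := by
    set Qm := (finSuccEquiv ℤ r).symm Q with hQm
    have hQmQ : finSuccEquiv ℤ r Qm = Q := by rw [hQm, AlgEquiv.apply_symm_apply]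
    have hQm_irr : Irreducible Qm := by
      rw [hQm]; exact (MulEquiv.irreducible_iff (finSuccEquiv ℤ r).symm.toMulEquiv).2 hQirr
    have hQm_deg : Qm.totalDegree ≠ 0 := by
      intro h0
      have h1 : Qm.degreeOf 0 = 0 := Nat.le_zero.1 ((degreeOf_le_totalDegree Qm 0).trans h0.le)
      have h2 := natDegree_finSuccEquiv Qm
      rw [hQmQ, h1] at h2
      omega
    have h := irreducible_map_int_rat hQm_irr hQm_deg
    have hfe : finSuccEquiv ℚ r (MvPolynomial.map (Int.castRingHom ℚ) Qm) = Qℚ := by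
      rw [Literature.AlgebraicGeometry.Motives.TwoPointPencil.finSuccEquiv_map, hQmQ]
    have h' := (MulEquiv.irreducible_iff (finSuccEquiv ℚ r).toMulEquiv).2 h
    have hcoe : (finSuccEquiv ℚ r).toMulEquiv (MvPolynomial.map (Int.castRingHom ℚ) Qm) = Qℚ := hfe
    rwa [hcoe] at h'
  -- `u` is integral over `ℚ[T]`
  have hu_int : ∃ p : Polynomial (MvPolynomial (Fin r) ℚ), p.Monic ∧ (p.map θℚ).eval u = 0 := by
    letI : Algebra (MvPolynomial (Fin r) ℚ) F₀ := θℚ.toAlgebra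
    have halgmap : algebraMap (MvPolynomial (Fin r) ℚ) F₀ = θℚ := rfl
    have hξint : ∀ j, IsIntegral (MvPolynomial (Fin r) ℚ) (ξ j) := fun j => by
      obtain ⟨p, hpm, hp⟩ := hint j
      refine ⟨p, hpm, ?_⟩
      rw [← Polynomial.eval_map, halgmap]; exact hp
    have huint : IsIntegral (MvPolynomial (Fin r) ℚ) u := by
      rw [hu]
      refine IsIntegral.sum _ fun j _ => ?_
      rw [← nsmul_eq_mul]
      exact (hξint j).nsmul (c j)
    obtain ⟨p, hpm, hp⟩ := huint
    refine ⟨p, hpm, ?_⟩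
    rw [Polynomial.eval_map, ← halgmap]; exact hp
  -- `Q(T̄, u) = 0` in the `θℚ`-form
  have hQℚu : (Qℚ.map θℚ).eval u = 0 := by
    rw [hQℚ, Polynomial.map_map, hθℚcomp, Polynomial.eval_map, ← Polynomial.coe_eval₂RingHom]
    exact hψQ
  obtain ⟨cQ, hcQ0, hlc⟩ := exists_leadingCoeff_eq_C_int θℚ hθℚ u hu_int Q hQℚirr hQℚu
  obtain ⟨-, -, -, hker⟩ := exists_leadingCoeff_eq_C_of_isIntegral θℚ hθℚ u hu_int Qℚ hQℚirr hQℚu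
  refine ⟨a, q, B, c, Q, cQ, haN', hqirr, hqdeg, hq𝒬, hBdeg, hBcoeff, hcN, hQdvd, hcQ0, hspRes, hlc, hQdeg, hQℚirr,
    ?_, ?_, hker⟩
  · rw [Polynomial.eval_map, ← Polynomial.coe_eval₂RingHom]
    exact hψQ
  · intro j
    rw [Polynomial.eval_map, ← Polynomial.coe_eval₂RingHom]
    exact hgraph j

end Summit.ValiantsHypothesis.ValiantsHypothesis.Theorems.LangWeilTransfer
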